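import Mathlib
import HarnessLib
import Literature.Probability.LatticeModels.ChessboardEstimateAssignments

/-!
# Stub `stub_abstractChessboard` of crux `ContinuumLegGivenGap`, line alternating-curvature-arrays

The chessboard estimate for label assignments on an even block torus `(ℤ/N)^d`, `d ≥ 1`
(Fröhlich–Israel–Lieb–Simon, Comm. Math. Phys. **62** (1978), Thms. 4.1/4.3; Biskup, LNM 1970
(2009), Thm. 5.8; Friedli–Velenik 2017, Thm. 10.11), in exactly the registered form consumed by the
line's derivation of `stub_chessboard` (abstract chessboard + Wilson reflection-positivity
instance): a direct application of the Literature theorem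
`Literature.Probability.LatticeModels.chessboard_abs_pow_le_prod_const`
(`Literature/Probability/LatticeModels/ChessboardEstimateAssignments.lean`), whose
`asgSymP`/`asgSymM` are the symmetrisations named in the registered signature.
-/

namespace Summit.QuantumFields.YangMills.Theorems.ContinuumLegGivenGap

open Literature.Probability.LatticeModels (asgSymP asgSymM)

/-- `stub_abstractChessboard` — **the chessboard estimate for label assignments**
(Fröhlich–Israel–Lieb–Simon 1978 Thms. 4.1/4.3 / Biskup 2009 Thm 5.8 / Friedli–Velenik Thm 10.11,
abstract form). On the block torus `(ℤ/N)^d` with `N` even and `d ≥ 1`, let `ψ` be a real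
functional of label assignments `σ : BlockIdx d N → ι` such that for every direction `i` and block
boundary `k` both symmetrisations `asgSymP i k σ`, `asgSymM i k σ` have non-negative value
(reflection positivity) and `ψ σ ^ 2 ≤ ψ (asgSymP i k σ) * ψ (asgSymM i k σ)` (reflection
Cauchy–Schwarz). Then `|ψ σ| ^ (N^d) ≤ ∏_c ψ (const (σ c))`. Proof: the Literature theorem
`chessboard_abs_pow_le_prod_const` (FILS's extremal argument on assignments).
[cite: FrohlichIsraelLiebSimon1978, Thm 4.1] -/
theorem stub_abstractChessboard :
    ∀ (d N : ℕ) [NeZero N], 0 < d → Even N → ∀ (ι : Type)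
      (ψ : (Literature.Barriers.CriticalPhenomena.NonGibbs.BlockIdx d N → ι) → ℝ),
      (∀ (i : Fin d) (k : ZMod N) (σ : Literature.Barriers.CriticalPhenomena.NonGibbs.BlockIdx d N → ι),
        0 ≤ ψ (asgSymP i k σ) ∧ 0 ≤ ψ (asgSymM i k σ) ∧ ψ σ ^ 2 ≤ ψ (asgSymP i k σ) * ψ (asgSymM i k σ)) →
      ∀ σ : Literature.Barriers.CriticalPhenomena.NonGibbs.BlockIdx d N → ι,
        |ψ σ| ^ (N ^ d) ≤ ∏ c, ψ (fun _ => σ c) :=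
  fun _ _ _ hd hN _ ψ h σ =>
    Literature.Probability.LatticeModels.chessboard_abs_pow_le_prod_const hd hN ψ h σ

end Summit.QuantumFields.YangMills.Theorems.ContinuumLegGivenGap
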